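import Summits.ABC.IUTFork.Joshi.LocalPeriodRingsSection
import HarnessLib

/-!
# [J-III] §5.2.5 (5.2.5.4) «`B̃_E = B ⊗_{ℚ_p} E = B_E ⊕ ··· ⊕ B_E` (`[E_0:ℚ_p]` factors)» — DERIVED from Lemma 5.2.3.1,
# `E_0/ℚ_p` Galois, and lifts of `Gal(E_0/ℚ_p)` to `B` (Frobenius functoriality)

Block E (rung LADDER-ABC:A2.E) of the abc-iut cell; seat abc-iut-E-t9 (slot T-09 = [J-III] §5; gen 3). PROOF-ONLY companion of
this seat's SIGNATURE file `Joshi/LocalPeriodRings.lean` (p429989: `PeriodRingTower`, `BEDatum`, `BE := B ⊔ E ⊂ B_dR`,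
`Btilde := B ⊗_{ℚ_p} E`, `btildeToBdR` (= the multiplication map `m`), the claim-`Prop`s `BELinDisjoint` (Lemma 5.2.3.1) and
`BtildeSplits` (5.2.5.4)), consuming BY NAME E-t58's `Joshi/LocalPeriodRingsSplitting.lean` ((5.2.5.3) under `[IsGalois ℚ_p E_0]`;
`exists_e0ToB`, `card_gal_E0`) and E-t13's `Joshi/LocalPeriodRingsSection.lean` (p446273: `e0ToB`, `e0ToE`, the separability
idempotent `sepIdem = ε_B ∈ B̃_E`, `btildeToBdR_eq_zero_iff`/`mem_balanceIdeal_of_btildeToBdR_eq_zero` = «`ker m` is the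
`E_0`-balancing ideal» from Lemma 5.2.3.1, `mul_sepIdem_eq_zero_of_mem`, `exists_btildeToBdR_eq`) and the tree's Galois splitting
`Literature.RingTheory.GaloisAlgebras.CharacterModuleTorus.splitEquivOver` (`L ⊗_k L ≅ ∏_{Gal(L/k)} L`). Source: K. Joshi,
*Construction of Arithmetic Teichmüller Spaces III*, arXiv:2401.13508**v4** = [J-III] (UNREFEREED «Preliminary version for comments»;
bib `Joshi2024ATS3`); locators «p.N l.a–b» = PDF page N, lines a–b of the cell's render `HOME/lit/renders/Joshi-arxiv-2401.13508/`.
DEFS-FREEZE respected (nothing re-declared); 0 `def`, no `Prop` definition, no new `Prop` fact, no instance, no notation, no axiom,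
0 `sorry`. TAKES NO SIDE on [IUTchIII] Cor. 3.12, on Joshi's claims or on Mochizuki's report on them; typed ≠ proved ≠ endorsed;
«derived» = OUR kernel check of OUR typed sentence, nothing more.

## What print says, what was open, what is derived here

* Print, (5.2.5.4) p.40 l.6–13: «`B̃_E = B_E ⊕ ··· ⊕ B_E` (`[E_0:ℚ_p]` factors) … `B̃_E = B ⊗_{ℚ_p} E` is naturally a finite and free
  `B`-module», obtained from (5.2.5.2) `B ⊗_{ℚ_p} E = (B ⊗_{ℚ_p} E_0) ⊗_{E_0} E`, (5.2.5.3) `B ⊗_{ℚ_p} E_0 = B^{⊕[E_0:ℚ_p]}` and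
  Lemma 5.2.3.1 `B_E ≃ B ⊗_{E_0} E` («Proof. This is [FF18, Prop. 1.6.9]»).
* The tree so far: (5.2.5.3) under `[IsGalois ℚ_[p] E_0]` (E-t58, who records that (5.2.5.4) «additionally needs Lemma 5.2.3.1 AND an
  identification of the `f` Galois-TWISTED copies `B_σ ⊗_{E_0} E` with `B_E` … NOT discharged»); (5.2.5.4) for `E = ℚ_p` and at the
  tower model (E-t11, `btildeSplits_of_E_eq_bot`, `towerBEDatum_btildeSplits`); (5.2.5.5) from Lemma 5.2.3.1 alone (E-t13, who records
  «What is NOT derived: (5.2.5.4) itself»).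
* HERE, **(5.2.5.4) `BtildeSplits` is DERIVED from EXACTLY**: (i) Lemma 5.2.3.1 `BELinDisjoint`; (ii) `[IsGalois ℚ_[p] ℰ.E0]` (print:
  «its maximal unramified subfield», §5.2.3 p.39 l.29–30 — unramified extensions of `ℚ_p` are cyclic Galois); (iii) **LIFTS**: every
  `σ ∈ Gal(E_0/ℚ_p)` extends along `E_0 → B` (§5.2.1 p.39 l.9–12 «`B` and `B⁺` are `E_0`-algebras») to a `ℚ_p`-algebra automorphism
  `τ_σ` of `B` — a BINDER `∀ σ, ∃ τ : B ≃ₐ[ℚ_[p]] B, ∀ c, τ (e0ToB c) = e0ToB (σ c)`, not a `Prop` definition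
  (`btildeSplits_of_linDisjoint_of_lifts`). In [FF18] (iii) is supplied by the Frobenius `φ` of `B = B_{ℂ_p^♭,ℚ_p}`: on
  `E_0 = W(k_E)[1/p] ⊂ W(F̄_p)[1/p] ⊂ B⁺` (§5.2.1 p.39 l.1–8) `φ` restricts to the arithmetic Frobenius, which GENERATES
  `Gal(E_0/ℚ_p)`; accordingly `btildeSplits_of_linDisjoint_of_frobB` derives (5.2.5.4) from (i), (ii) and «the signature's own `T.frobB`
  preserves `E_0` and induces a generator of `Gal(E_0/ℚ_p)`» (`lifts_of_frobB`). The isomorphism is explicit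
  (`exists_btildeEquiv_of_lifts`): `B ⊗_{ℚ_p} E ≅ ∏_{σ ∈ Gal(E_0/ℚ_p)} B_E`, `b ⊗ x ↦ (ι(τ_σ b)·x)_σ`, i.e. the `σ`-coordinate is
  `m ∘ (τ_σ ⊗ 1)`; re-indexed by `Gal(E_0/ℚ_p) ≃ Fin [E_0:ℚ_p]` (E-t58's `card_gal_E0`).
* PROOF SHAPE. The `f` elements `ε_σ := (τ_σ⁻¹ ⊗ 1)(ε_B) ∈ B̃_E` (E-t13's separability idempotent transported by the lifts) satisfy
  `m((τ_ρ ⊗ 1) ε_σ) = [ρ = σ]` (`btildeToBdR_map_map_symm_sepIdem_self`/`_of_ne`; from `μ((γ ⊗ 1)ε) = [γ = 1]` in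
  `E_0 ⊗_{ℚ_p} E_0`, `GaloisSepIdem.splitHomOver_elem_one`/`_of_ne_one`) and `Σ_σ ε_σ = 1` (`sum_map_symm_sepIdem`; from `Σ_γ (γ ⊗ 1)ε = 1`,
  `GaloisSepIdem.sum_galBaseChange_elem`, via the Galois splitting of `E_0 ⊗_{ℚ_p} E_0`). Injectivity: if every coordinate of `z`
  vanishes then, by Lemma 5.2.3.1 in E-t13's form «`m w = 0 ⇒ w·ε_B = 0`», `z·ε_σ = 0` for all `σ`, so `z = z·Σ_σ ε_σ = 0`
  (`eq_zero_of_forall_btildeToBdR_map_eq_zero`); surjectivity: `z := Σ_σ ε_σ·(τ_σ⁻¹ ⊗ 1)(w_σ)` with `m w_σ = y_σ`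
  (`exists_forall_btildeToBdR_map_eq`).
* LOCATED, NOT ADJUDICATED (for the referee lanes): (iii) is NOT idle given (i)–(ii) — for an extension `E ⊋ E_0` the `σ`-twisted base
  changes `B ⊗_{E_0,σ} E` of (5.2.5.2)–(5.2.5.3) need not be isomorphic to `B ⊗_{E_0} E = B_E` when `σ` does not extend to `B` (desk
  example over `k = ℚ` in place of `ℚ_p`: `E_0 = ℚ(√2) ⊂ B = ℚ(⁴√2)`, `E = ℚ(√(1+√2))`, linearly disjoint from `B` over `E_0`; then
  `B ⊗_ℚ E ≅ B(√(1+√2)) × B(√(1−√2))`, one totally real factor and one with no real place, whereas `B_E × B_E = B(√(1+√2))²`).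
  So print's (5.2.5.4) uses the Frobenius functoriality of `B` beyond Lemma 5.2.3.1 — in the [FF18] setting a standard fact; in the
  T-09 typing, whose `BEDatum` carries `E_0` only as data and does not relate `φ_B` to `E_0`, an input to be NAMED, which this file does.
  A second sufficient input, recorded by E-t13 (STATUS 13:13:57Z) and NOT derived here: `E/ℚ_p` Galois — twist `E` instead of `B`
  (`τ ∈ Gal(E/ℚ_p)` with `τ|_{E_0} = σ`, coordinate `m ∘ (1 ⊗ τ⁻¹)`); neither case contains the other, and print's general `E = E′_w`
  is served by (iii).

bears_on: LADDER-ABC:A2.E. [claim: Joshi2024ATS3, status: disputed]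
-/

noncomputable section

open scoped TensorProduct

namespace Summit.ABC.IUTFork.Joshi.ATS3

/-! ## 1. Two identities of the separability idempotent of a finite Galois extension `L/k` -/

namespace GaloisSepIdem

open Literature.RingTheory.GaloisAlgebras.CharacterModuleTorus

variable (k L : Type*) [Field k] [Field L] [Algebra k L] [Algebra.FormallyUnramified k L] [Algebra.EssFiniteType k L]

omit [Algebra.FormallyUnramified k L] [Algebra.EssFiniteType k L] in
/-- The `1`-coordinate of the Galois splitting `L ⊗_k L → ∏_{Gal(L/k)} L` is the multiplication map `μ`. [folklore] -/
theorem splitHomOver_apply_one (z : L ⊗[k] L) :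
    splitHomOver k L L z 1 = Algebra.TensorProduct.lmul' (S := L) k z := by
  induction z using TensorProduct.induction_on with
  | zero => simp only [map_zero, Pi.zero_apply]
  | tmul x y =>
      rw [splitHomOver_tmul, Algebra.TensorProduct.lmul'_apply_tmul, AlgEquiv.one_apply, Algebra.algebraMap_self_apply]
  | add x y hx hy => rw [map_add, Pi.add_apply, hx, hy, map_add]

/-- **`μ(ε) = 1`**: the `1`-coordinate of the separability idempotent `ε ∈ L ⊗_k L` under the Galois splitting
`l ⊗ r ↦ (σ(l) r)_σ`. [folklore] -/
theorem splitHomOver_elem_one : splitHomOver k L L (Algebra.FormallyUnramified.elem k L) 1 = 1 := by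
  rw [splitHomOver_apply_one, Algebra.FormallyUnramified.lmul_elem]

/-- **`μ((σ ⊗ 1) ε) = 0` for `σ ≠ 1`**: the other coordinates of `ε` vanish (for `c` with `σ(c) ≠ c` the relation
`(1 ⊗ c)ε = (c ⊗ 1)ε` gives `(σ(c) − c)·ε_σ = 0`) — `ε` is the idempotent cutting out the diagonal. [folklore] -/
theorem splitHomOver_elem_of_ne_one {σ : L ≃ₐ[k] L} (hσ : σ ≠ 1) :
    splitHomOver k L L (Algebra.FormallyUnramified.elem k L) σ = 0 := by
  obtain ⟨c, hc⟩ : ∃ c : L, σ c ≠ c := not_forall.1 fun h => hσ (AlgEquiv.ext h)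
  have h := congrArg (fun z => splitHomOver k L L z σ)
    (Algebra.FormallyUnramified.one_tmul_mul_elem (R := k) (S := L) c)
  simp only [map_mul, Pi.mul_apply, splitHomOver_tmul, map_one, one_mul, mul_one, Algebra.algebraMap_self_apply] at h
  -- `h : c * ε_σ = σ c * ε_σ`
  have h' : (σ c - c) * splitHomOver k L L (Algebra.FormallyUnramified.elem k L) σ = 0 := by
    rw [sub_mul, ← h, sub_self]
  exact (mul_eq_zero.1 h').resolve_left (sub_ne_zero.2 hc)

variable [FiniteDimensional k L] [IsGalois k L]

/-- **`Σ_{σ ∈ Gal(L/k)} (σ ⊗ 1) ε = 1`** in `L ⊗_k L` for `L/k` finite Galois (under the Galois splitting the left side has every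
coordinate `Σ_σ [ρσ = 1] = 1`). [folklore] -/
theorem sum_galBaseChange_elem [Fintype (L ≃ₐ[k] L)] :
    ∑ σ : L ≃ₐ[k] L, galBaseChange k L L σ (Algebra.FormallyUnramified.elem k L) = 1 := by
  refine (splitEquivOver k L L).injective ?_
  rw [map_sum, map_one]
  funext ρ
  simp only [Finset.sum_apply, splitEquivOver_apply, splitHomOver_galBaseChange, Pi.one_apply]
  rw [Finset.sum_eq_single ρ⁻¹]
  · rw [mul_inv_cancel, splitHomOver_elem_one]
  · intro σ _ hσ
    exact splitHomOver_elem_of_ne_one k L fun h => hσ (eq_inv_of_mul_eq_one_right h)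
  · intro hρ
    exact absurd (Finset.mem_univ _) hρ

end GaloisSepIdem

/-! ## 2. Transport to `B̃_E = B ⊗_{ℚ_p} E` along lifts `τ_σ` of `Gal(E_0/ℚ_p)` to `B` -/

namespace PeriodRingTower

namespace BEDatum

open Literature.RingTheory.GaloisAlgebras.CharacterModuleTorus

variable {F B E0 : Type} [Field F] [CommRing B] [Field E0] {Y : Type} {K : Y → Type} [∀ y, Field (K y)]
  {G : Type} [Group G] {D : PeriodRingDatum F B E0 Y K G} {p : ℕ} [Fact p.Prime] [Algebra ℚ_[p] B]
  {Ω : Type} [Field Ω] [Algebra ℚ_[p] Ω] {T : PeriodRingTower D p Ω} (ℰ : T.BEDatum)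

/-- Transport of `(E_0 → B) ⊗ (E_0 ⊂ E)` along a `ℚ_p`-algebra map `g : B → B` extending `γ ∈ Gal(E_0/ℚ_p)`:
`(g ⊗ 1) ∘ ((E_0 → B) ⊗ (E_0 ⊂ E)) = ((E_0 → B) ⊗ (E_0 ⊂ E)) ∘ (γ ⊗ 1)`. [folklore] -/
theorem map_map_e0 (g : B →ₐ[ℚ_[p]] B) (γ : ℰ.E0 ≃ₐ[ℚ_[p]] ℰ.E0) (hg : ∀ c, g (ℰ.e0ToB c) = ℰ.e0ToB (γ c))
    (z : ℰ.E0 ⊗[ℚ_[p]] ℰ.E0) :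
    Algebra.TensorProduct.map g (AlgHom.id ℚ_[p] ℰ.E) (Algebra.TensorProduct.map ℰ.e0ToB ℰ.e0ToE z) =
      Algebra.TensorProduct.map ℰ.e0ToB ℰ.e0ToE (galBaseChange ℚ_[p] ℰ.E0 ℰ.E0 γ z) := by
  induction z using TensorProduct.induction_on with
  | zero => simp only [map_zero]
  | tmul x y =>
      rw [Algebra.TensorProduct.map_tmul, Algebra.TensorProduct.map_tmul, hg, galBaseChange_tmul,
        Algebra.TensorProduct.map_tmul, AlgHom.id_apply]
  | add x y hx hy => simp only [map_add, hx, hy]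

/-- A lift `τ` of `σ` along `E_0 → B` has inverse lifting `σ⁻¹`. [folklore] -/
theorem symm_e0ToB_of_lift {τ : B ≃ₐ[ℚ_[p]] B} {σ : ℰ.E0 ≃ₐ[ℚ_[p]] ℰ.E0} (hτ : ∀ c, τ (ℰ.e0ToB c) = ℰ.e0ToB (σ c))
    (c : ℰ.E0) : τ.symm (ℰ.e0ToB c) = ℰ.e0ToB (σ⁻¹ c) := by
  rw [AlgEquiv.symm_apply_eq, hτ, ← AlgEquiv.mul_apply, mul_inv_cancel, AlgEquiv.one_apply]

/-- `(τ⁻¹ ⊗ 1) ∘ (τ ⊗ 1) = 1` on `B̃_E`. [folklore] -/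
theorem map_symm_map (τ : B ≃ₐ[ℚ_[p]] B) (z : ℰ.Btilde) :
    Algebra.TensorProduct.map (τ.symm : B →ₐ[ℚ_[p]] B) (AlgHom.id ℚ_[p] ℰ.E)
      (Algebra.TensorProduct.map (τ : B →ₐ[ℚ_[p]] B) (AlgHom.id ℚ_[p] ℰ.E) z) = z := by
  induction z using TensorProduct.induction_on with
  | zero => simp only [map_zero]
  | tmul x y => simp only [Algebra.TensorProduct.map_tmul, AlgHom.id_apply, AlgEquiv.coe_toAlgHom, AlgEquiv.symm_apply_apply]
  | add x y hx hy => simp only [map_add, hx, hy]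

/-- `(τ ⊗ 1) ∘ (τ⁻¹ ⊗ 1) = 1` on `B̃_E`. [folklore] -/
theorem map_map_symm (τ : B ≃ₐ[ℚ_[p]] B) (z : ℰ.Btilde) :
    Algebra.TensorProduct.map (τ : B →ₐ[ℚ_[p]] B) (AlgHom.id ℚ_[p] ℰ.E)
      (Algebra.TensorProduct.map (τ.symm : B →ₐ[ℚ_[p]] B) (AlgHom.id ℚ_[p] ℰ.E) z) = z := by
  induction z using TensorProduct.induction_on with
  | zero => simp only [map_zero]
  | tmul x y => simp only [Algebra.TensorProduct.map_tmul, AlgHom.id_apply, AlgEquiv.coe_toAlgHom, AlgEquiv.apply_symm_apply]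
  | add x y hx hy => simp only [map_add, hx, hy]

/-- **The transported idempotents `ε_σ := (τ_σ⁻¹ ⊗ 1)(ε_B)`** are images of `(σ⁻¹ ⊗ 1)ε ∈ E_0 ⊗_{ℚ_p} E_0`. [folklore] -/
theorem map_symm_sepIdem_eq {τ : B ≃ₐ[ℚ_[p]] B} {σ : ℰ.E0 ≃ₐ[ℚ_[p]] ℰ.E0} (hτ : ∀ c, τ (ℰ.e0ToB c) = ℰ.e0ToB (σ c)) :
    haveI := ℰ.formallyUnramified_E0
    haveI := ℰ.essFiniteType_E0
    Algebra.TensorProduct.map (τ.symm : B →ₐ[ℚ_[p]] B) (AlgHom.id ℚ_[p] ℰ.E) ℰ.sepIdem =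
      Algebra.TensorProduct.map ℰ.e0ToB ℰ.e0ToE
        (galBaseChange ℚ_[p] ℰ.E0 ℰ.E0 σ⁻¹ (Algebra.FormallyUnramified.elem ℚ_[p] ℰ.E0)) :=
  ℰ.map_map_e0 _ σ⁻¹ (ℰ.symm_e0ToB_of_lift hτ) _

/-- **`m((τ ⊗ 1)((τ⁻¹ ⊗ 1) ε_B)) = m(ε_B) = 1`**: the own coordinate of a transported idempotent. [folklore] -/
theorem btildeToBdR_map_map_symm_sepIdem_self (τ : B ≃ₐ[ℚ_[p]] B) :
    ℰ.btildeToBdR (Algebra.TensorProduct.map (τ : B →ₐ[ℚ_[p]] B) (AlgHom.id ℚ_[p] ℰ.E)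
      (Algebra.TensorProduct.map (τ.symm : B →ₐ[ℚ_[p]] B) (AlgHom.id ℚ_[p] ℰ.E) ℰ.sepIdem)) = 1 := by
  rw [ℰ.map_map_symm, ℰ.btildeToBdR_sepIdem]

/-- **`m((τ_ρ ⊗ 1) ε_σ) = 0` for `ρ ≠ σ`**: the other coordinates of the transported idempotent `ε_σ := (τ_σ⁻¹ ⊗ 1)(ε_B)`
vanish (`μ((ρσ⁻¹ ⊗ 1)ε) = 0` in `E_0 ⊗_{ℚ_p} E_0`). [folklore] -/
theorem btildeToBdR_map_map_symm_sepIdem_of_ne {τρ τσ : B ≃ₐ[ℚ_[p]] B} {ρ σ : ℰ.E0 ≃ₐ[ℚ_[p]] ℰ.E0}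
    (hρ : ∀ c, τρ (ℰ.e0ToB c) = ℰ.e0ToB (ρ c)) (hσ : ∀ c, τσ (ℰ.e0ToB c) = ℰ.e0ToB (σ c)) (hne : ρ ≠ σ) :
    ℰ.btildeToBdR (Algebra.TensorProduct.map (τρ : B →ₐ[ℚ_[p]] B) (AlgHom.id ℚ_[p] ℰ.E)
      (Algebra.TensorProduct.map (τσ.symm : B →ₐ[ℚ_[p]] B) (AlgHom.id ℚ_[p] ℰ.E) ℰ.sepIdem)) = 0 := by
  haveI := ℰ.formallyUnramified_E0
  haveI := ℰ.essFiniteType_E0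
  rw [ℰ.map_symm_sepIdem_eq hσ, ℰ.map_map_e0 _ ρ hρ, ← AlgEquiv.mul_apply, ← map_mul, ℰ.btildeToBdR_map_eq,
    ← GaloisSepIdem.splitHomOver_apply_one, splitHomOver_galBaseChange, one_mul,
    GaloisSepIdem.splitHomOver_elem_of_ne_one ℚ_[p] ℰ.E0 fun h => hne (mul_inv_eq_one.1 h)]
  rfl

/-- **`Σ_σ ε_σ = 1`** in `B̃_E`, for a family of lifts `τ_σ` of all of `Gal(E_0/ℚ_p)` (`E_0/ℚ_p` Galois). [folklore] -/
theorem sum_map_symm_sepIdem [IsGalois ℚ_[p] ℰ.E0] [Fintype (ℰ.E0 ≃ₐ[ℚ_[p]] ℰ.E0)]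
    (τ : (ℰ.E0 ≃ₐ[ℚ_[p]] ℰ.E0) → (B ≃ₐ[ℚ_[p]] B)) (hτ : ∀ σ c, τ σ (ℰ.e0ToB c) = ℰ.e0ToB (σ c)) :
    ∑ σ, Algebra.TensorProduct.map ((τ σ).symm : B →ₐ[ℚ_[p]] B) (AlgHom.id ℚ_[p] ℰ.E) ℰ.sepIdem = 1 := by
  haveI := ℰ.formallyUnramified_E0
  haveI := ℰ.essFiniteType_E0
  haveI := ℰ.finiteDimensional_E0
  simp_rw [fun σ => ℰ.map_symm_sepIdem_eq (hτ σ)]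
  rw [← map_sum, Fintype.sum_equiv (Equiv.inv _)
    (fun σ => galBaseChange ℚ_[p] ℰ.E0 ℰ.E0 σ⁻¹ (Algebra.FormallyUnramified.elem ℚ_[p] ℰ.E0))
    (fun σ => galBaseChange ℚ_[p] ℰ.E0 ℰ.E0 σ (Algebra.FormallyUnramified.elem ℚ_[p] ℰ.E0)) (fun σ => rfl),
    GaloisSepIdem.sum_galBaseChange_elem, map_one]

/-- **Injectivity** of `(m ∘ (τ_σ ⊗ 1))_σ : B̃_E → ∏_σ B_E`, from Lemma 5.2.3.1 («`m w = 0 ⇒ w·ε_B = 0`», E-t13) and `Σ_σ ε_σ = 1`.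
[claim: Joshi2024ATS3, status: disputed] -/
theorem eq_zero_of_forall_btildeToBdR_map_eq_zero [IsGalois ℚ_[p] ℰ.E0] (h : ℰ.BELinDisjoint)
    (τ : (ℰ.E0 ≃ₐ[ℚ_[p]] ℰ.E0) → (B ≃ₐ[ℚ_[p]] B)) (hτ : ∀ σ c, τ σ (ℰ.e0ToB c) = ℰ.e0ToB (σ c)) {z : ℰ.Btilde}
    (hz : ∀ σ, ℰ.btildeToBdR (Algebra.TensorProduct.map (τ σ : B →ₐ[ℚ_[p]] B) (AlgHom.id ℚ_[p] ℰ.E) z) = 0) :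
    z = 0 := by
  haveI := ℰ.finiteDimensional_E0
  have hε : ∀ σ, z * Algebra.TensorProduct.map ((τ σ).symm : B →ₐ[ℚ_[p]] B) (AlgHom.id ℚ_[p] ℰ.E) ℰ.sepIdem = 0 :=
    fun σ => by
    have h1 := ℰ.mul_sepIdem_eq_zero_of_mem (ℰ.mem_balanceIdeal_of_btildeToBdR_eq_zero h (hz σ))
    have h2 := congrArg (Algebra.TensorProduct.map ((τ σ).symm : B →ₐ[ℚ_[p]] B) (AlgHom.id ℚ_[p] ℰ.E)) h1
    rwa [map_mul, map_zero, ℰ.map_symm_map] at h2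
  calc z = z * ∑ σ, Algebra.TensorProduct.map ((τ σ).symm : B →ₐ[ℚ_[p]] B) (AlgHom.id ℚ_[p] ℰ.E) ℰ.sepIdem := by
          rw [ℰ.sum_map_symm_sepIdem τ hτ, mul_one]
    _ = 0 := by rw [Finset.mul_sum]; exact Finset.sum_eq_zero fun σ _ => hε σ

/-- **Surjectivity** of `(m ∘ (τ_σ ⊗ 1))_σ : B̃_E → ∏_σ B_E` (by the idempotents `ε_σ`; no Lemma 5.2.3.1 needed).
[claim: Joshi2024ATS3, status: disputed] -/
theorem exists_forall_btildeToBdR_map_eq [IsGalois ℚ_[p] ℰ.E0]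
    (τ : (ℰ.E0 ≃ₐ[ℚ_[p]] ℰ.E0) → (B ≃ₐ[ℚ_[p]] B)) (hτ : ∀ σ c, τ σ (ℰ.e0ToB c) = ℰ.e0ToB (σ c))
    (y : (ℰ.E0 ≃ₐ[ℚ_[p]] ℰ.E0) → T.BE ℰ.E) :
    ∃ z : ℰ.Btilde, ∀ ρ,
      ℰ.btildeToBdR (Algebra.TensorProduct.map (τ ρ : B →ₐ[ℚ_[p]] B) (AlgHom.id ℚ_[p] ℰ.E) z) = (y ρ : Ω) := by
  haveI := ℰ.finiteDimensional_E0
  choose w hw using fun σ => ℰ.exists_btildeToBdR_eq (y σ)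
  refine ⟨∑ σ, Algebra.TensorProduct.map ((τ σ).symm : B →ₐ[ℚ_[p]] B) (AlgHom.id ℚ_[p] ℰ.E) ℰ.sepIdem *
      Algebra.TensorProduct.map ((τ σ).symm : B →ₐ[ℚ_[p]] B) (AlgHom.id ℚ_[p] ℰ.E) (w σ), fun ρ => ?_⟩
  rw [map_sum, map_sum, Finset.sum_eq_single ρ]
  · rw [map_mul, map_mul, ℰ.btildeToBdR_map_map_symm_sepIdem_self, one_mul, ℰ.map_map_symm, hw]
  · intro σ _ hσ
    rw [map_mul, map_mul, ℰ.btildeToBdR_map_map_symm_sepIdem_of_ne (hτ ρ) (hτ σ) (Ne.symm hσ), zero_mul]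
  · intro hρ
    exact absurd (Finset.mem_univ ρ) hρ

/-! ## 3. (5.2.5.4) -/

/-- **(5.2.5.4), canonical form**: given Lemma 5.2.3.1, `E_0/ℚ_p` Galois and lifts `τ_σ` (`σ ∈ Gal(E_0/ℚ_p)`) to `B`, there is a
`ℚ_p`-algebra isomorphism **`B̃_E = B ⊗_{ℚ_p} E ≅ ∏_{σ ∈ Gal(E_0/ℚ_p)} B_E`, `b ⊗ x ↦ (ι(τ_σ b)·x)_σ`**.
[claim: Joshi2024ATS3, status: disputed] -/
theorem exists_btildeEquiv_of_lifts [IsGalois ℚ_[p] ℰ.E0] (h : ℰ.BELinDisjoint)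
    (τ : (ℰ.E0 ≃ₐ[ℚ_[p]] ℰ.E0) → (B ≃ₐ[ℚ_[p]] B)) (hτ : ∀ σ c, τ σ (ℰ.e0ToB c) = ℰ.e0ToB (σ c)) :
    ∃ e : ℰ.Btilde ≃ₐ[ℚ_[p]] ((ℰ.E0 ≃ₐ[ℚ_[p]] ℰ.E0) → T.BE ℰ.E),
      ∀ (b : B) (x : ℰ.E) (σ : ℰ.E0 ≃ₐ[ℚ_[p]] ℰ.E0), (e (b ⊗ₜ[ℚ_[p]] x) σ : Ω) = T.toBdR (τ σ b) * (x : Ω) := by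
  have hmem : ∀ (σ : ℰ.E0 ≃ₐ[ℚ_[p]] ℰ.E0) (z : ℰ.Btilde),
      (ℰ.btildeToBdR.comp (Algebra.TensorProduct.map (τ σ : B →ₐ[ℚ_[p]] B) (AlgHom.id ℚ_[p] ℰ.E))) z ∈ T.BE ℰ.E :=
    fun σ z => by
    rw [← ℰ.btildeToBdR_range]
    exact ⟨_, rfl⟩
  let ψ : (σ : ℰ.E0 ≃ₐ[ℚ_[p]] ℰ.E0) → (ℰ.Btilde →ₐ[ℚ_[p]] T.BE ℰ.E) := fun σ =>
    (ℰ.btildeToBdR.comp (Algebra.TensorProduct.map (τ σ : B →ₐ[ℚ_[p]] B) (AlgHom.id ℚ_[p] ℰ.E))).codRestrict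
      (T.BE ℰ.E) (hmem σ)
  have hψ : ∀ σ z, ((ψ σ z : T.BE ℰ.E) : Ω) =
      ℰ.btildeToBdR (Algebra.TensorProduct.map (τ σ : B →ₐ[ℚ_[p]] B) (AlgHom.id ℚ_[p] ℰ.E) z) := fun σ z => rfl
  let Ψ : ℰ.Btilde →ₐ[ℚ_[p]] ((ℰ.E0 ≃ₐ[ℚ_[p]] ℰ.E0) → T.BE ℰ.E) := AlgHom.pi ψ
  have hΨ : Function.Bijective Ψ := by
    refine ⟨(injective_iff_map_eq_zero Ψ).2 fun z hz => ?_, fun y => ?_⟩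
    · refine ℰ.eq_zero_of_forall_btildeToBdR_map_eq_zero h τ hτ fun σ => ?_
      rw [← hψ]
      have hσ : Ψ z σ = 0 := by rw [hz]; rfl
      rw [AlgHom.pi_apply] at hσ
      rw [hσ]
      rfl
    · obtain ⟨z, hz⟩ := ℰ.exists_forall_btildeToBdR_map_eq τ hτ y
      exact ⟨z, funext fun ρ => Subtype.ext ((hψ ρ z).trans (hz ρ))⟩
  refine ⟨AlgEquiv.ofBijective Ψ hΨ, fun b x σ => ?_⟩
  rw [AlgEquiv.ofBijective_apply, AlgHom.pi_apply, hψ, Algebra.TensorProduct.map_tmul, BEDatum.btildeToBdR,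
    Algebra.TensorProduct.productMap_apply_tmul]
  rfl

/-- **J3:(5.2.5.4) DERIVED modulo named inputs** (p.40 l.6–13 «`B̃_E = B_E ⊕ ··· ⊕ B_E` (`[E_0:ℚ_p]` factors)»): T-09's
claim-`Prop` `BtildeSplits` HOLDS given (i) Lemma 5.2.3.1 `BELinDisjoint` ([FF18, Prop. 1.6.9]), (ii) `E_0/ℚ_p` Galois, (iii) every
`σ ∈ Gal(E_0/ℚ_p)` lifts along `E_0 → B` to a `ℚ_p`-algebra automorphism of `B`. FQ type. [claim: Joshi2024ATS3, status: disputed] -/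
theorem btildeSplits_of_linDisjoint_of_lifts [IsGalois ℚ_[p] ℰ.E0] (h : ℰ.BELinDisjoint)
    (hlift : ∀ σ : ℰ.E0 ≃ₐ[ℚ_[p]] ℰ.E0, ∃ τ : B ≃ₐ[ℚ_[p]] B, ∀ c, τ (ℰ.e0ToB c) = ℰ.e0ToB (σ c)) :
    Summit.ABC.IUTFork.Joshi.ATS3.PeriodRingTower.BEDatum.BtildeSplits ℰ := by
  choose τ hτ using hlift
  obtain ⟨e, -⟩ := ℰ.exists_btildeEquiv_of_lifts h τ hτ
  haveI := ℰ.finiteDimensional_E0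
  let ν : (ℰ.E0 ≃ₐ[ℚ_[p]] ℰ.E0) ≃ Fin ℰ.f := (Finite.equivFin _).trans (finCongr ℰ.card_gal_E0)
  exact ⟨e.trans (AlgEquiv.piCongrLeft' ℚ_[p] (fun _ : ℰ.E0 ≃ₐ[ℚ_[p]] ℰ.E0 => T.BE ℰ.E) ν)⟩

/-! ## 4. The lifts from the Frobenius `φ` of `B` ([FF18]: `φ|_{E_0}` generates `Gal(E_0/ℚ_p)`, `E_0 = W(k_E)[1/p]`) -/

/-- If the signature's Frobenius `T.frobB` preserves `E_0 ⊂ B`, inducing `σ₀ ∈ Gal(E_0/ℚ_p)`, and `σ₀` generates `Gal(E_0/ℚ_p)`,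
then every `σ = σ₀ⁿ` lifts to `φⁿ`. [folklore] -/
theorem lifts_of_frobB (σ₀ : ℰ.E0 ≃ₐ[ℚ_[p]] ℰ.E0) (hσ₀ : ∀ c, T.frobB (ℰ.e0ToB c) = ℰ.e0ToB (σ₀ c))
    (hgen : ∀ σ : ℰ.E0 ≃ₐ[ℚ_[p]] ℰ.E0, σ ∈ Submonoid.powers σ₀) (σ : ℰ.E0 ≃ₐ[ℚ_[p]] ℰ.E0) :
    ∃ τ : B ≃ₐ[ℚ_[p]] B, ∀ c, τ (ℰ.e0ToB c) = ℰ.e0ToB (σ c) := by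
  obtain ⟨n, rfl⟩ := (Submonoid.mem_powers_iff _ _).1 (hgen σ)
  refine ⟨T.frobB ^ n, fun c => ?_⟩
  induction n generalizing c with
  | zero => rw [pow_zero, pow_zero, AlgEquiv.one_apply, AlgEquiv.one_apply]
  | succ n ih => rw [pow_succ', pow_succ', AlgEquiv.mul_apply, AlgEquiv.mul_apply, ih, hσ₀]

/-- **J3:(5.2.5.4) DERIVED in the [FF18] shape**: `BtildeSplits` HOLDS given Lemma 5.2.3.1, `E_0/ℚ_p` Galois, and «`φ_B` preserves
`E_0` and `φ_B|_{E_0}` generates `Gal(E_0/ℚ_p)`». FQ type. [claim: Joshi2024ATS3, status: disputed] -/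
theorem btildeSplits_of_linDisjoint_of_frobB [IsGalois ℚ_[p] ℰ.E0] (h : ℰ.BELinDisjoint)
    (σ₀ : ℰ.E0 ≃ₐ[ℚ_[p]] ℰ.E0) (hσ₀ : ∀ c, T.frobB (ℰ.e0ToB c) = ℰ.e0ToB (σ₀ c))
    (hgen : ∀ σ : ℰ.E0 ≃ₐ[ℚ_[p]] ℰ.E0, σ ∈ Submonoid.powers σ₀) :
    Summit.ABC.IUTFork.Joshi.ATS3.PeriodRingTower.BEDatum.BtildeSplits ℰ :=
  ℰ.btildeSplits_of_linDisjoint_of_lifts h (ℰ.lifts_of_frobB σ₀ hσ₀ hgen)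

end BEDatum

end PeriodRingTower

end Summit.ABC.IUTFork.Joshi.ATS3

end
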